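import Summits.HodgeConjecture.HodgeConjecture.Theses.PadicSemiregularLift
import Summits.HodgeConjecture.HodgeConjecture.Theorems.PadicSemiregularLiftFermatAnchorAssemblyAfterPridham
import Summits.HodgeConjecture.HodgeConjecture.Theorems.HodgeFermatVarieties.Negative.DegreeZeroVacuous
import Literature.AlgebraicGeometry.HodgeTheory.FermatHodgeConjectureAokiProofs
import Literature.AlgebraicGeometry.HodgeTheory.FermatClaimShiodaSpine
import Summits.HodgeConjecture.HodgeConjecture.Theorems.PadicSemiregularLiftFermatAnchorAssemblyGMFDefs
import Summits.HodgeConjecture.HodgeConjecture.Theorems.PadicSemiregularLiftFermatAnchorAssemblyStubEulerBaseChange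
import Summits.HodgeConjecture.HodgeConjecture.Theorems.PadicSemiregularLiftFermatAnchorAssemblyStubRigidLift
import Summits.HodgeConjecture.HodgeConjecture.Theorems.PadicSemiregularLiftFermatAnchorAssemblyStubReadout
import Literature.AlgebraicGeometry.HodgeTheory.FermatAokiClaimPStandardLeaves
import Literature.AlgebraicGeometry.HodgeTheory.FermatEigenspaceMultiplicityOne
import Summits.HodgeConjecture.HodgeConjecture.Theorems.PadicSemiregularLiftFermatAnchorAssemblyStubLatticeReductionOfFacts
import Summits.HodgeConjecture.HodgeConjecture.Theorems.PadicSemiregularLiftFermatAnchorAssemblyLevelMapPullback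
import Summits.HodgeConjecture.HodgeConjecture.Theorems.PadicSemiregularLiftFermatAnchorAssemblyReadoutCoreOfComplex
import Literature.AlgebraicGeometry.HodgeTheory.AokiShiodaSurfaceEigenlinesHolds
import Literature.AlgebraicGeometry.HodgeTheory.FermatSurfaceLinesRepresent
import Summits.HodgeConjecture.HodgeConjecture.Theorems.PadicSemiregularLiftFermatAnchorAssemblyStubEigenclassExists
import Literature.AlgebraicGeometry.HodgeTheory.FermatConeSpanMirror

/-!
# Line `witt-lift-rigid-mf` — skeleton for crux `FermatAnchorAssembly` (stmt-HodgeConjecture-14874), generation 11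

GEN 11 (lead c7, cycle 2, after wave 3, 2026-08-17T18:40Z): (a) `stub_eigenclassExists` is DISCHARGED — Ran 1980 Prop. 1.7 (i), existence
half, is a theorem of the tree (`Ran1980_fermatEigenspace_ne_bot`, Literature/AlgebraicGeometry/HodgeTheory/FermatEigenspaceNonvanishing.lean,
p171879: Pham–Brieskorn eigenvectors in `H_{2r}(U)` pushed to `H_{2r}(X(ℂ))`, kernel bounded through `H_{2r+1}(X,U) ≅ H^{2r−1}(X^{2r−1}ₘ)` and the
odd-degree restriction bound), hence S2↑ `claimLevelPull` is UNCONDITIONAL (Theorems/…StubEigenclassExists.lean, p172068; Fulton eliminated p168368,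
Bredon no longer needed) and enters `latticeReduction_of_stubs` by name. (b) `stub_juxtapositionSpans` RESHAPED to (II) ∧ (III-l): (III-r) follows from
(III-l) (`Shioda1979_coneSpan_represents_right_of_left`, p171599), the character-sum criterion (p171678) and the CLEAN-INTERSECTION BASE CHANGE for
`complexGysin` (`complexGysin_cleanBaseChange`, `complexGysin_baseChange_of_commonSection`, p172058; p171861) are landed, and the honest cone-span host
(de Jong vertex blow-up, `exists_vertexBlowup_isSmoothProjective`) exists — (III-l) is now recipe-ready (work/stubs/gysin_cleanBaseChange_STATUS.md §3).
Registered stubs after gen 11 (6): `stub_readoutCoreComplex`, `stub_rigidSeeds`, `stub_juxtapositionSpans`, `stub_pairedAndSemiDecomposable`,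
`stub_pStandard`, `stub_hodgeTypePP`.

GEN 10 (lead c7, cycle 2, after wave 2, 2026-08-17T16:50Z): INTEGRATION of the wave. (a) `stub_surfaceEigenlines` is
DISCHARGED — the named fact `AokiShioda1983_eigenline_le_neronSeveri` is now a theorem of the tree (`…_holds`, p170565,
Literature/AlgebraicGeometry/HodgeTheory/AokiShiodaSurfaceEigenlinesHolds.lean + 13 files: Liouville on a generic line of the
μₘ³-quotient plane) and is used BY NAME (the stub disappears). (b) `stub_claimLevelPull` RESHAPED to its one remaining leaf:
Fulton Cor. 19.2 (b) is ELIMINATED for the level map (`map_mem_algebraicClasses_of_fermatLevelMap`, p168368: π finite ⟹ quasi-finite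
pull-back preserves coniveau, p167104/p167129) and the transfer (M4) is reduced by eigenspace count to the EXISTENCE of Fermat
eigenclasses (`claimLevelPull_of_exists_eigenclass`, p168540); new stub `stub_eigenclassExists` (Ran Prop. 1.7 (i), existence half:
`V(α) ≠ 0` for admissible `α`, `r ≥ 1`). (c) `stub_readoutCore` RESHAPED to its complex case `stub_readoutCoreComplex` through the landed
WLOG-`K = ℂ` reduction `readoutCore_of_complex` (p170906: descent to the countable coefficient field + `Literature.FieldTheory.AlgClosed`
embedding into ℂ p166812 + base change p163731). (d) `stub_inductiveSpans` SPLIT along the landed leaf (IV) `Shioda1979_lines_represent_holds`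
(p170621): `stub_juxtapositionSpans` = the three remaining span leaves (II), (III-l), (III-r) of Aoki Thm 1-4 (i), and `stub_pairedAndSemiDecomposable`
= Thm 1-4 (ii) ∧ Shioda's semi-decomposable sextuples. Registered stubs after gen 10 (7): `stub_readoutCoreComplex`, `stub_rigidSeeds`,
`stub_juxtapositionSpans`, `stub_pairedAndSemiDecomposable`, `stub_pStandard`, `stub_eigenclassExists`, `stub_hodgeTypePP`.

GEN 9 (lead c7, cycle 2, 2026-08-17T14:40Z): `stub_latticeReduction` RESHAPED into its printed inputs so that the
wave can work the FACT DEBT in parallel (one worker per registered stub). The registered `stub_latticeReduction`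
statement (`ReductionStatement`) is now DERIVED (`latticeReduction_of_stubs`, sorry-free) from the landed reduction
`latticeReduction_of_cancelLatticeStubs` (p141595) over FIVE fact-shaped stubs: `stub_inductiveSpans`
(Aoki 1987 Thm 1-4 (i),(ii) + Shioda's semi-decomposable sextuples — the span/Gysin layer), `stub_pStandard`
(Aoki Thm 2-1), `stub_surfaceEigenlines` (Aoki–Shioda (2.1)), `stub_claimLevelPull` (S2↑: claim pulls back along
`[xᵢ] ↦ [xᵢᵏ]`; today `stub_claimLevelPull_of_facts` over Fulton Cor. 19.2 (b) + Bredon II.19.2, but provable for the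
level map alone: finite flat pull-back preserves coniveau (`map_mem_algebraicClasses_of_flat` is a theorem) + the
eigenspace count for the transfer), `stub_hodgeTypePP` (Ran Prop. 1.7 (ii)). Registered stubs after gen 9 (7 =
stubs_max): `stub_readoutCore`, `stub_rigidSeeds`, `stub_inductiveSpans`, `stub_pStandard`, `stub_surfaceEigenlines`,
`stub_claimLevelPull`, `stub_hodgeTypePP`; `FermatAnchorAssembly_of` unchanged in shape.

GEN 8 (lead c7, prover-line-stmt-HodgeConjecture-14874-c7-0, 2026-08-17T13:40Z): stub STATEMENTS UNCHANGED (the same three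
registered `sorry`s: `stub_readoutCore`, `stub_rigidSeeds`, `stub_latticeReduction`). State carried: L1∞/L2 are theorems
(p144424, p144063); `stub_readoutCore` is print-known and vocabulary-blocked (F1–F6, Lines/witt-lift-rigid-mf-readoutCore-blockers-c6.md);
`stub_latticeReduction` is reduced to its 8 printed named facts (p151425); `stub_rigidSeeds` ⟺ its characteristic-0 form RS₀
(STRUCTURE-c6 (EQ)) — the crux content. This generation's work is on the HYPOTHESIS of `stub_rigidSeeds` (the residual set:
`gap₃₅` is residual at every level — order-7 parity functional, STRUCTURE-c7) and on the hand-back packet for the planner.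

GEN 7 (lead c6, prover-line-stmt-HodgeConjecture-14874-c6-0, 2026-08-17T09:30Z): stub STATEMENTS UNCHANGED (three registered `sorry`s:
`stub_readoutCore`, `stub_rigidSeeds`, `stub_latticeReduction`); what changed is landed support and the dossier of `stub_rigidSeeds`:
(i) the strategist's SPLIT GLUE is landed — `Theorems/PadicSemiregularLiftFermatAnchorAssemblySplit.lean` (p150596):
`FermatAnchorAssemblySplit.fermatAnchorAssembly_of_subs : FermatLatticeLayer → FermatResidualClaims → FermatAnchorAssembly`
(`FermatLatticeLayer` = `ReductionStatement` below verbatim), so the route can be `--split` with `--glue-by`; (ii) the SELECTION RULE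
`cyclotomic_dvd_thetaPoly_top_of_isRigid` / `not_isRigid_of_not_cyclotomic_dvd_thetaPoly_top` (Theorems/…RigidThetaTop.lean, p151372):
an `L`-rigid seed's `⊤`-graded charge polynomial is that of a characteristic-0 factorization (L1∞ + L2 at `L = ⊤`), hence — granted the
characteristic-0 vanishing of `Θ^⊤_γ` at non-(r,r) eigenlines (Orlov + HRR + HKR, the inputs of `stub_readoutCore`) — every seed is NUMERICALLY
HODGE: Tate cycles of the special fibre charged at a non-(r,r) eigenline (graphs of Frobenius, ruled joins, Hermitian subspaces) are never
rigid (STRUCTURE-c6 §3, = the idea card's rule (5) proved in the skeleton's vocabulary); (iii) consequently (STRUCTURE-c6 §4, (EQ))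
`SeedStatement` ⟺ its characteristic-0 form `RS₀` (an `H`-rigid `γ`-charged object over `ℚ̄`): the special fibre is search space, not
existence leverage, and `stub_rigidSeeds` is claim(γ) PLUS rigidity — strictly crux-sized; (iv) lattice facts for `FermatResidualClaims`:
unit-invariant sign functionals at 14 of 17 bad levels (no twisted-graph residual classes there, incl. `gap₃₅`), Frobenius-type residual
ten-tuples at 55 = the 110 class (STRUCTURE-c6 §1–§2).

GEN 6 (lead c5, 2026-08-17T07:25Z): `stub_eigenspaceLine` DISCHARGED — the named fact `Ran1980_fermatEigenspace_le_span` is now a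
theorem of the tree (`…_holds`, p146069) and is used directly; THREE registered stubs remain: `stub_readoutCore` (Orlov + HRR + HKR core),
`stub_rigidSeeds` (crux content; STRUCTURE-c5 v6), `stub_latticeReduction` (crux 1334's S0/S2↑/S5b via p141595).

GEN 5 (lead c5, 2026-08-17T06:20Z): `stub_readout` RESHAPED into its two printed inputs `stub_eigenspaceLine`
(= named fact `Ran1980_fermatEigenspace_le_span`, by name) and `stub_readoutCore` (Orlov + HRR + HKR), the registered
statement being derived by `readout_of_core` over the landed `claim_of_represented` (p141768). Registered stubs after gen 5:
`stub_eigenspaceLine`, `stub_readoutCore`, `stub_rigidSeeds`, `stub_latticeReduction` (4); landed: `stub_rigidLift` (p144424),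
`stub_eulerBaseChange` (p144063).

GEN 4 (lead c5, 2026-08-17T06:10Z): `stub_rigidLift` LANDED (p144424) and is imported; THREE registered stubs remain —
`stub_readout` (named-fact shaped: Orlov + HRR/Mukai + HKR + Ran's dim V(γ) ≤ 1; trivial cases / assembly / L^⊥-rescaling landed
p141768, p142351), `stub_rigidSeeds` (crux content; STRUCTURE-c5 memo), `stub_latticeReduction` (crux 1334's S0/S2↑/S5b via p141595).

GEN 3 (lead c5, 2026-08-17T06:00Z): `stub_eulerBaseChange` LANDED (p144063) and is imported; four registered stubs remain
(`stub_readout`, `stub_rigidLift` [landing: Aux p143138, Step p143607 accepted, Main pending], `stub_rigidSeeds`, `stub_latticeReduction`).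

GEN 2 (lead c5, prover-line-stmt-HodgeConjecture-14874-c5-0, 2026-08-17): the vocabulary moved to the landed Defs file
`Theorems/PadicSemiregularLiftFermatAnchorAssemblyGMFDefs.lean` (p141072) and is imported; the five registered stubs and the
sorry-free composition are UNCHANGED (statements byte-identical). Landed so far under this seat: p141595
(`latticeReduction_of_cancelLatticeStubs`: `stub_latticeReduction` the day crux 1334's S0/S2-up/S5b close), p141763, p141768.

Route `PadicSemiregularLift`, crux (rank-9 glue node)

    FermatAnchorAssembly := PadicPridhamSemiregularity → FormalLiftingFromClassLifting →
      FormalVectorBundlesAlgebraize → HodgeFermatVarieties.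

Idea `witt-lift-rigid-mf` (Cruxes/FermatAnchorAssembly/Ideas/witt-lift-rigid-mf.md; triage r2-1 PASS,
r2-2 PASS): LIFT THE MATRIX FACTORIZATION, NOT THE CYCLE. For a residual (sign) Hodge character `γ` of
level `M'` take a graded matrix factorization `(φ, ψ)` of the Fermat form `Σ xᵢ^{M'}` over a perfect
field `𝕜` of characteristic `p ∤ M'` that is graded by the character group of `H = L^⊥ ⊆ ker γ`
(`γ ∈ L`) and RIGID there (`Hom_{HMF^{gr,L}}(M, M(M')) = 0`, the obstruction group of the lifting
problem). Such an `M` lifts to `𝕎 𝕜` by linear algebra (`stub_rigidLift`), its twisted Euler forms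
`χ(M, g^*M)` (`g ∈ μ_{M'}^ν`) are invariant under `𝕎 𝕜 → 𝕜` and `𝕎 𝕜 → K ⊃ ℚ`
(`stub_eulerBaseChange`), and in characteristic `0` the Fourier coefficient
`Θ_γ = Σ_g γ(g) χ(N, g^*N) = |G|·⟨ch(N)_γ, ch(N)_{γ̄}⟩ ≠ 0` (Mukai pairing, `G`-invariant) certifies
`ch(N)_γ ≠ 0`, hence — Orlov's theorem `HMF^gr(Σxᵢ^{M'}) ⊇ D^b(X^{2r}_{M'})` `G`-equivariantly,
equivariant HKR, Chern classes of perfect complexes algebraic, `dim V(γ) = 1` — `claim(γ)`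
(`stub_readout`). The certificate is the DECIDABLE statement
`¬ Φ_{M'}(T) ∣ Σ_g χ(M, g^*M)·T^{⟨γ,g⟩}` in `ℤ[T]`, independent of the primitive root used.
`stub_rigidSeeds` (THE CRUX CONTENT) asks such a rigid charged seed for every residual sign class of
crux stmt-1334's lattice reduction (one per bad degree; first `gap₃₅ ⊂ H⁶(X⁶₃₅)`), with the freedom
of level raising `[x] ↦ [xᵏ]` and pair inflation `γ ↦ γ ∗ (a, −a)`; `stub_latticeReduction` is
crux 1334's line `cancel-by-any-claim-lattice` MINUS its engine stub S4 (printed theorems only: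
Aoki 1987 Thm 1-4, Shioda 1979, Ran 1980 Prop 1.7), entered through
`Theorems.FermatAnchorAssemblyAfterPridham.fermatAnchorAssembly_of_hodgeFermatVarieties`.

VOCABULARY (this file, CONSTRUCTIVE — matrices of `MvPolynomial`s, no hypothesis structures):
`GMFData` (degree labels + two matrices), `GMF` (+ bihomogeneity + `φψ = ψφ = f·1`), `GMFData.map`
(base change), `.shift` (`N[1]`), `.twist` (`g^*N`, `xᵢ ↦ ζ^{gᵢ} xᵢ`), `homDim` (`dim Hom(M, N(t))`
as the `finrank` of closed/null-homotopic bihomogeneous matrix pairs), `eulerForm`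
(`χ(M,N) = Σ_j (dim Hom(M,N[2j]) − dim Hom(M,N[2j+1]))`), `thetaPoly`, `IsRigid`, and the witness
records `RigidSeed`, `CharZeroModel`. Every carrier computes; small cases are `decide`-able in principle.

Disproof used (Cruxes/FermatAnchorAssembly/Disproof.lean v2, read 2026-08-17): §1 — NO
`_false_without_<H>` exists (each engine hypothesis is removable iff HC(Fermat)); this line is
ENGINE-FREE in the typed sense (h1b is a theorem, p139071; h1a, h3a unused): it proves the consequent
for the residual classes and enters by `fermatAnchorAssembly_of_hodgeFermatVarieties`
(= `fermatAnchorAssembly_of_without.2.2.2`). §2 `hodgeFermatVarieties_iff_two_le` — consistent (the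
reduction stub is per degree, all `n`). §3–§4 (anchors, `CrystallineRealization`, `ZeroOneSeedsFor`,
tightness `seeds_force_middleCyclePart`) — NOT APPLICABLE: no `Anchor`, no realization, no
`IsZeroOneSemiregular`; the four walls of `Lines/Sketch-dead.md` §"Why no term of Anchor" are absent.
Landed Negative lemmas: `Theorems/FermatAnchorAssembly/Negative/*` concern the dead line's
`ZeroOneSeeds` vocabulary (not instantiated here); `Theorems/HodgeFermatVarieties/Negative/DegreeZeroVacuous`
is IMPORTED and used for `m = 0`. Negatives index (stmt-11121 K3Exhaustion, stmt-12555
ELineConnectivity): no stub asserts exhaustion by a sector; `{1,24,62,71,81,91}` at `m = 110` is an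
INSTANCE of `stub_rigidSeeds`' hypothesis, never claimed reachable.
-/

set_option linter.dupNamespace false

noncomputable section

open CategoryTheory AlgebraicGeometry Finset
open Literature.AlgebraicGeometry Literature.AlgebraicGeometry.Motives
open Literature.AlgebraicGeometry.HodgeTheory Literature.AlgebraicGeometry.HodgeTheory.FermatCharacter
open Literature.AlgebraicTopology.SingularHomology
open Summit.HodgeConjecture.HodgeConjecture.Theses.PadicSemiregularLift

namespace Summit.HodgeConjecture.HodgeConjecture.Cruxes.FermatAnchorAssembly.WittLiftRigidMf

/-! ### Vocabulary I–II (GMFData/GMF/homDim/eulerForm/thetaPoly/IsRigid/RigidSeed/CharZeroModel, rankOne)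
now live in the importable Defs file `Theorems/PadicSemiregularLiftFermatAnchorAssemblyGMFDefs.lean`
(p141072, lead c5, gen 2) — one copy shared by the skeleton and every stub file. -/

/-! ### Vocabulary III — crux 1334's reach vocabulary (LOCAL NOTATIONS, copied verbatim from
`Cruxes/HodgeFermatVarieties/Lines/cancel-by-any-claim-lattice.lean`; they expand to terms over the
tree's `IsHodgeMultiset` / `IsSemiDecomposable` / `ClaimMultiset`) -/

/-- `Supply[M]` — the printed supply of level `M` (pairs, Hodge 4-multisets, semi-decomposable Hodge
sextuples, Aoki's standard elements). Local notation only (crux 1334). -/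
local notation3 (prettyPrint := false) "Supply[" M "]" =>
  ({s : Multiset (ZMod M) | ∃ a : ZMod M, a ≠ 0 ∧ s = ({a, -a} : Multiset (ZMod M))} ∪
    {s : Multiset (ZMod M) | IsHodgeMultiset s ∧ Multiset.card s = 4} ∪
    {s : Multiset (ZMod M) | IsHodgeMultiset s ∧ IsSemiDecomposable s} ∪
    {s : Multiset (ZMod M) | ∃ (p : ℕ) (a : ZMod M), p.Prime ∧ p ≠ 2 ∧ p ∣ M ∧
        2 < (M / p) / Nat.gcd (ZMod.val a) (M / p) ∧
        s = Multiset.map (fun j : ℕ => a + (j : ZMod M) * ((M / p : ℕ) : ZMod M)) (Multiset.range p) +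
              {-((p : ZMod M) * a)}} : Set (Multiset (ZMod M)))

/-- `Reach[M, s]` — ℤ-reachability of `s` from the printed supply of level `M`. Local notation only (crux 1334). -/
local notation3 (prettyPrint := false) "Reach[" M ", " s "]" =>
  ∃ P N : Multiset (Multiset (ZMod M)),
    (∀ u ∈ P, u ∈ Supply[M]) ∧ (∀ u ∈ N, u ∈ Supply[M]) ∧ s + Multiset.sum N = Multiset.sum P

/-- `LevelRaise[k, m, s]` — pull-back of the value multiset along `[xᵢ] ↦ [xᵢᵏ]`. Local notation only (crux 1334). -/
local notation3 (prettyPrint := false) "LevelRaise[" k ", " m ", " s "]" =>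
  Multiset.map (fun a : ZMod m => ((k * ZMod.val a : ℕ) : ZMod (k * m))) s

/-- `StableReach[m, s]` — reachable after some level raising. Local notation only (crux 1334). -/
local notation3 (prettyPrint := false) "StableReach[" m ", " s "]" =>
  ∃ k : ℕ, 0 < k ∧ Reach[k * m, LevelRaise[k, m, s]]

/-! ### The statements of the five stubs (spelled once, as `abbrev`s, so that `lineImplication` is a
kernel-checked certificate that the registered stub STATEMENTS compose into the crux) -/

/-- Statement of `stub_readout`. -/
abbrev ReadoutStatement : Prop :=
  ∀ (m r : ℕ) [NeZero m] (K : Type) [Field K] [CharZero K] (ζ : K), IsPrimitiveRoot ζ m →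
    ∀ (γ : Fin (2 * r + 2) → ZMod m), (∀ i, γ i ≠ 0) →
    ∀ (ι₀ ι₁ : Type) [Fintype ι₀] [Fintype ι₁] [DecidableEq ι₀] [DecidableEq ι₁]
      (L : AddSubgroup (Fin (2 * r + 2) → ZMod m)) (N : GMF K (2 * r + 2) m L ι₀ ι₁),
      ¬ (Polynomial.cyclotomic m ℤ ∣ GMFData.thetaPoly K L ζ γ N.toGMFData) → Claim m r γ

/-- Statement of `stub_rigidLift`. -/
abbrev LiftStatement : Prop :=
  ∀ (p : ℕ) [Fact p.Prime] (𝕜 : Type) [Field 𝕜] [CharP 𝕜 p] [PerfectRing 𝕜 p] (ν m : ℕ)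
    (ι₀ ι₁ : Type) [Fintype ι₀] [Fintype ι₁] [DecidableEq ι₀] [DecidableEq ι₁]
    (L : AddSubgroup (Fin ν → ZMod m)) (M : GMF 𝕜 ν m L ι₀ ι₁), GMFData.IsRigid 𝕜 L M.toGMFData →
    ∃ MW : GMF (WittVector p 𝕜) ν m L ι₀ ι₁,
      MW.toGMFData.map (WittVector.constantCoeff : WittVector p 𝕜 →+* 𝕜) = M.toGMFData

/-- Statement of `stub_eulerBaseChange`. -/
abbrev BaseChangeStatement : Prop :=
  ∀ (p : ℕ) [Fact p.Prime] (𝕜 : Type) [Field 𝕜] [CharP 𝕜 p] [PerfectRing 𝕜 p] (ν m : ℕ) [NeZero m],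
    ¬ p ∣ m → ∀ (ζ : 𝕜), IsPrimitiveRoot ζ m → ∀ (γ : Fin ν → ZMod m)
    (ι₀ ι₁ : Type) [Fintype ι₀] [Fintype ι₁] [DecidableEq ι₀] [DecidableEq ι₁]
    (L : AddSubgroup (Fin ν → ZMod m)) (MW : GMF (WittVector p 𝕜) ν m L ι₀ ι₁),
    Nonempty (CharZeroModel L ι₀ ι₁ γ
      (GMFData.thetaPoly 𝕜 L ζ γ (MW.toGMFData.map (WittVector.constantCoeff : WittVector p 𝕜 →+* 𝕜))))

/-- Statement of `stub_rigidSeeds`. -/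
abbrev SeedStatement : Prop :=
  ∀ (m : ℕ) [NeZero m] (s : Multiset (ZMod m)), s ≠ 0 → IsHodgeMultiset s → ¬ StableReach[m, s] →
    ∃ (k : ℕ) (A : Multiset (ZMod ((k + 1) * m))) (r : ℕ) (γ : Fin (2 * r + 2) → ZMod ((k + 1) * m)),
      (∀ a ∈ A, a ≠ 0) ∧ (∀ i, γ i ≠ 0) ∧
      univ.val.map γ = LevelRaise[k + 1, m, s] + A.bind (fun a ↦ ({a, -a} : Multiset _)) ∧
      Nonempty (RigidSeed ((k + 1) * m) γ)

/-- Statement of `stub_latticeReduction`. -/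
abbrev ReductionStatement : Prop :=
  ∀ (m : ℕ) [NeZero m],
    (∀ s : Multiset (ZMod m), s ≠ 0 → IsHodgeMultiset s → ¬ StableReach[m, s] →
      ∃ (k : ℕ) (A : Multiset (ZMod ((k + 1) * m))), (∀ a ∈ A, a ≠ 0) ∧
        ClaimMultiset ((k + 1) * m) (LevelRaise[k + 1, m, s] + A.bind (fun a ↦ ({a, -a} : Multiset _)))) →
    ∀ ⦃n : ℕ⦄ ⦃X : SchemeOver ℂ⦄, IsFermatVariety n m X → IsSmoothProjective n X → HodgeConjectureFor n X

/-! ### The registered stubs -/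

/-! ### L3 — the readout, RESHAPED (gen 5, lead c5) into its two printed inputs

The registered `stub_readout` (`ReadoutStatement`) is now DERIVED (`readout_of_core`, sorry-free) from the
landed assembly `claim_of_represented` (p141768: trivial cases `r = 0` / `Σγᵢ ≠ 0` folded in, then the tree's
`FermatCharacter.claim_of_represents`) and TWO stubs that are exactly its printed inputs:
`stub_eigenspaceLine` = the tree's named fact `Ran1980_fermatEigenspace_le_span` (`dim V(γ) ≤ 1`, Ran 1980
Prop. 1.7 (i); a literature-prover's `_holds` closes it) and `stub_readoutCore` = the categorical content
(Orlov + HRR/Mukai pairing + HKR: `Θ_{γ,N}(ζ) ≠ 0 ⟹` some algebraic class has non-zero `γ`-component). -/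

/-- Statement of `stub_readoutCore`: the CATEGORICAL CORE of the readout. For `0 < r`, `Σ γᵢ = 0`, all
`γᵢ ≠ 0`, a field `K ⊇ ℚ` with a primitive `m`-th root `ζ` and a lawful `L`-graded factorization `N` of
`Σ_{i<2r+2} xᵢᵐ` over `K` with `Φₘ ∤ Θ_{γ,N}`: some class `c` in the `ℂ`-span of the codimension-`r` algebraic
cycles of `X²ʳₘ` has `π_γ c ≠ 0`. [cite: BallardFaveroKatzarkov2011, Thm. 7.1 and Thm. 10.26]
[cite: PolishchukVaintrob2012, Thm. 1.3.1] -/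
abbrev ReadoutCoreStatement : Prop :=
  ∀ (m r : ℕ) [NeZero m] (K : Type) [Field K] [CharZero K] (ζ : K), IsPrimitiveRoot ζ m →
    ∀ (γ : Fin (2 * r + 2) → ZMod m), (∀ i, γ i ≠ 0) → 0 < r → ∑ i, γ i = 0 →
    ∀ (ι₀ ι₁ : Type) [Fintype ι₀] [Fintype ι₁] [DecidableEq ι₀] [DecidableEq ι₁]
      (L : AddSubgroup (Fin (2 * r + 2) → ZMod m)) (N : GMF K (2 * r + 2) m L ι₀ ι₁),
      ¬ (Polynomial.cyclotomic m ℤ ∣ GMFData.thetaPoly K L ζ γ N.toGMFData) →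
      ∃ c ∈ algebraicClasses (fermatHypersurface (2 * r) m) r, fermatProjector m γ (2 * r) c ≠ 0

/-! `stub_eigenspaceLine` (L3a, = named fact `Ran1980_fermatEigenspace_le_span`) is DISCHARGED: `Ran1980_fermatEigenspace_le_span_holds`
(`Literature/AlgebraicGeometry/HodgeTheory/FermatEigenspaceMultiplicityOne.lean`, p146069, wave-2 worker of lead c5: Pham–Brieskorn
multiplicity one on the join transported to `V(α)` by restriction to the affine chart, the fibre homeomorphism and Kronecker duality). It is
imported and used by name in `FermatAnchorAssembly_of`. -/

/-- **L3b `stub_readoutCore` — THE CATEGORICAL CORE OF THE CHARACTERISTIC-ZERO READOUT (named-fact shaped;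
size XL as formalisation, research risk low).** PROOF IN PRINT: (0) Lefschetz principle (coefficients in a
countable `K₀ ↪ ℂ`; `homDim` is base-change invariant — cf. the landed `finrank` bookkeeping of
`…EulerBaseChangeRank`); (1) HRR for the smooth proper dg category `HMF^{gr,L}` (Polishchuk–Vaintrob
Thm. 1.3.1; Shklyarov): `χ(M,N) = ⟨ch M, ch N⟩`, the pairing `G`-invariant, so
`Θ_{γ,N}(ζ) = Σ_g γ(g) χ(N, g^*N) = |G|·⟨ch(N)_γ, ch(N)_{γ⁻¹}⟩ ≠ 0 ⟹ ch(N)_γ ≠ 0` — equivalently (lead c5,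
STRUCTURE-c5 §2, kernel of the isotypic argument checked numerically): writing `HMF^{gr,L}` as the orbit
category `D^b(k[1,m−1]^{2r+2}) / L`, `Θ_{γ,N}(ζ) = |L^⊥|·STr(γ | Ext•(P,P))` for the periodic object `P`
under `N`, and `Θ ≡ 0` when `γ ∉ L` (LANDED: `thetaPoly_dvd_of_not_mem`, p142351 ff.); (2) BFK Thm. 10.26:
for `γ` with all `γᵢ ≠ 0` the `γ`-isotypic part of `HH₀(HMF^{gr,L})` is the full-fixed-locus sector, a
line, present iff `γ ∈ L` is of middle Hodge type; forgetting to the `ℤ`-grading (BFK 10.26 (iii)) and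
Orlov's theorem (BFK Thm. 7.1 / Orlov 2009 Thm. 2.5, all cases `2r+2 ⋛ m`, exceptional objects
`G`-invariant) give the `D^b(X²ʳₘ)`-component `E` of `N` with `ch(E)_γ ≠ 0`; (3) HKR (Căldăraru, Mukai
pairing II Thm. 4.5): the categorical Chern character is the classical one, `HH₀(X) = ⊕_q H^{q,q}`, the
classes `h^q` are invariant, so `π_γ ch_r(E) ≠ 0`; (4) `ch_r(E)` is an algebraic class (resolutions on the
smooth projective `X`), i.e. `c := ch_r(E) ∈ algebraicClasses _ r` with `fermatProjector m γ (2r) c ≠ 0`.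
WHY IT MIGHT FAIL: only through a normalisation slip in `homDim`/`eulerForm` — excluded by the landed
calibrations (C0/C1 tables, `Θ = |Stab|` on the paired lattice; STRUCTURE-c5 §1–§2).
GEN 10: registered in its COMPLEX CASE `stub_readoutCoreComplex` (`K = ℂ`; step (0) of the printed proof —
Lefschetz principle — is landed: `readoutCore_of_complex`, p170906); blocked on F1–F6 as before
(Lines/witt-lift-rigid-mf-readoutCore-blockers-c6.md). -/
theorem stub_readoutCoreComplex :
    ∀ (m r : ℕ) [NeZero m] (ζ : ℂ), IsPrimitiveRoot ζ m →
    ∀ (γ : Fin (2 * r + 2) → ZMod m), (∀ i, γ i ≠ 0) → 0 < r → ∑ i, γ i = 0 →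
    ∀ (ι₀ ι₁ : Type) [Fintype ι₀] [Fintype ι₁] [DecidableEq ι₀] [DecidableEq ι₁]
      (L : AddSubgroup (Fin (2 * r + 2) → ZMod m)) (N : GMF ℂ (2 * r + 2) m L ι₀ ι₁),
      ¬ (Polynomial.cyclotomic m ℤ ∣ GMFData.thetaPoly ℂ L ζ γ N.toGMFData) →
      ∃ c ∈ algebraicClasses (fermatHypersurface (2 * r) m) r, fermatProjector m γ (2 * r) c ≠ 0 := by
  sorry

/-- Statement of `stub_readoutCoreComplex`: the readout core OVER `ℂ` (gen 10; the registered `stub_readoutCore`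
statement `ReadoutCoreStatement` over an arbitrary field of characteristic `0` follows from it by the landed
WLOG-`K = ℂ` reduction `readoutCore_of_complex`, p170906). -/
abbrev ReadoutCoreComplexStatement : Prop :=
  ∀ (m r : ℕ) [NeZero m] (ζ : ℂ), IsPrimitiveRoot ζ m →
    ∀ (γ : Fin (2 * r + 2) → ZMod m), (∀ i, γ i ≠ 0) → 0 < r → ∑ i, γ i = 0 →
    ∀ (ι₀ ι₁ : Type) [Fintype ι₀] [Fintype ι₁] [DecidableEq ι₀] [DecidableEq ι₁]
      (L : AddSubgroup (Fin (2 * r + 2) → ZMod m)) (N : GMF ℂ (2 * r + 2) m L ι₀ ι₁),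
      ¬ (Polynomial.cyclotomic m ℤ ∣ GMFData.thetaPoly ℂ L ζ γ N.toGMFData) →
      ∃ c ∈ algebraicClasses (fermatHypersurface (2 * r) m) r, fermatProjector m γ (2 * r) c ≠ 0

/-- **The registered `stub_readoutCore` statement (gen 5–9), DERIVED** (sorry-free) from its complex case:
descent of the lawful factorization to its countable coefficient field, an embedding of that field into `ℂ`
(`Literature.FieldTheory.AlgClosed.Subfield.nonempty_ringHom_closure_complex`, p166812) and base change
(p163731) preserve lawfulness, `Θ` and the primitive root — `readoutCore_of_complex` (p170906). [folklore assembly] -/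
theorem readoutCore_of_complexStub (hC : ReadoutCoreComplexStatement) : ReadoutCoreStatement :=
  readoutCore_of_complex hC

/-- **The registered `stub_readout` statement, DERIVED** (sorry-free) from the two reshaped stubs through the
landed assembly `claim_of_represented` (p141768). [folklore assembly] -/
theorem readout_of_core (hE : Ran1980_fermatEigenspace_le_span) (hC : ReadoutCoreStatement) :
    ReadoutStatement := by
  intro m r _ K _ _ ζ hζ γ hγ ι₀ ι₁ _ _ _ _ L N hΘ
  exact claim_of_represented m r γ (fun hr hs ↦ hE m r γ hr ⟨hγ, hs⟩)
    (fun hr hs ↦ hC m r K ζ hζ γ hγ hr hs ι₀ ι₁ L N hΘ)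

/-! `stub_rigidLift` (L1∞) is LANDED: `Theorems/PadicSemiregularLiftFermatAnchorAssemblyStubRigidLift.lean` (p144424, wave-1
worker of lead c5; H1 `closedSet_subset_nullSet_of_isRigid` p143138, H2 `liftStep` p143607, coefficientwise p-adic limit; axioms
standard). It is imported and used by name in `FermatAnchorAssembly_of`. -/

/-! `stub_eulerBaseChange` (L2) is LANDED: `Theorems/PadicSemiregularLiftFermatAnchorAssemblyStubEulerBaseChange.lean`
(p144063, wave-1 worker of lead c5; H4 = `eulerForm_baseChange`, Hom-finiteness `finite_setOf_homDim_ne_zero`, Witt rank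
semicontinuity `finrank_span_residue_le`; axioms standard). It is imported and used by name in `FermatAnchorAssembly_of`. -/

/-- **L4 `stub_rigidSeeds` — THE CRUX CONTENT (open; hardest): every residual sign class has a rigid
charged seed on a supersingular Fermat fibre.** For every level `m ≥ 1` and every non-empty Hodge
multiset `s` that is NOT stably reachable from the printed supply (crux 1334's engine hypothesis
verbatim: vacuous at every saturated degree — all prime powers, all `m ≤ 32`, `33`, `99`, … — and ONE
`ℤ/2`-coset at `35, 44, 51, 52, 55, 57, …`; first instance `gap₃₅ = {1,2,16,17,21,22,30,31} ⊂ H⁶(X⁶₃₅)`,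
functorially CLEAN by triage r2-1 calc/ks_refined.py), there are: a level multiple `(k+1)m`, nonzero
residues `A` (pair inflation `∗ (a, −a)`), an arrangement `γ` of `(k+1)•s + Σ_{a∈A} {a, −a}` as a
character of `X²ʳ_{(k+1)m}`, and a `RigidSeed` for `γ`: a prime `p ∤ (k+1)m`, a perfect field
`𝕜 ∋ ζ` (intended `𝔽_{q²}`, `(k+1)m ∣ q + 1`, the Shioda–Katsura supersingular fibre where EVERY
eigenline is algebraic, so charged objects exist: pushed-down unitary/Hermitian factorizations, cones,
high syzygies of non-CI graded MCM modules), a subgroup `L ∋ γ` and a lawful `L`-graded factorization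
`M` of `Σxᵢ^{(k+1)m}` over `𝕜` with `Hom(M, M((k+1)m))^{L-deg 0} = 0` and `Φ_{(k+1)m} ∤ Θ_{γ,M}`. EACH
CANDIDATE IS DECIDED BY FINITE LINEAR ALGEBRA over `𝔽_{q²}` (ranks of explicit matrices) plus one
divisibility in `ℤ[T]`.
NON-VACUITY IN KIND (paper, this plan — the positive calibration the triage asked for): for every
PAIRED character `δ = (a₀,−a₀,…,a_r,−a_r)` and `p ∤ m` the Koszul factorization
`M_Λ = ⊗ᵢ (x_{2i} − εᵢx_{2i+1}, (x_{2i}ᵐ + x_{2i+1}ᵐ)/(x_{2i} − εᵢx_{2i+1}))` of the standard linear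
subspace `Λ` is an `L`-RIGID CHARGED SEED with `L = Stab(Λ)^⊥ = {(b₀,−b₀,…,b_r,−b_r)} ∋ δ`: by Künneth
(the rank-one factors `(ℓ, q)` have `End_stable = k[x]/(x^{m−1})` and NO odd self-maps, `gcd(ℓ,q) = 1`)
`Hom(M_Λ, M_Λ(m))` has basis `x₀^{t₀}x₂^{t₁}⋯x_{2r}^{t_r}`, `Σtᵢ = m`, `0 ≤ tᵢ ≤ m−2`, of
`Stab(Λ)`-character `(t₀, t₁, …)`, so the invariant part (`m ∣ tᵢ`) is ZERO although the total space is
not (`m − 3` for lines on `X²ₘ` = `dim Ext²(𝒪_ℓ,𝒪_ℓ)`, `12` for planes on `X⁴₅` = `h¹(N_{P/X})`); fed to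
L1∞ + L2 + L3 these seeds reprove Shioda's Thm 1-1 (claim for paired characters). So `RigidSeed` is
inhabited in every dimension, total rigidity (`L = ⊤`) is never needed, and the card's "H = ker γ is
forced / cycle-type seeds are never rigid" is corrected to: cycle-type seeds are `Stab`-rigid exactly
when no `Stab`-INVARIANT element of `H¹(N_{Z/X})` (⊕ the other local pieces) survives — for residual
`γ` the open question is whether some `Stab`-symmetric object (necessarily NOT a linear subspace, whose
charges are paired, nor an exterior product, whose charges are of type I) carries `γ`-charge with
`Hom(M,M(m))^{Stab} = 0`. WHY IT MIGHT FAIL: for non-paired `γ` every charged object may have a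
surviving invariant obstruction class (e.g. the `𝒪_X(m)|_Z`-piece of `H¹(N_{Z/X})` contains the
invariant monomial images for Aoki's standard `Y` or Shioda's type-II joins), and at the residual
classes no cycle is known over any field where one computes (Das 2000); decisive cheap tests (line
card F1♯): `Stab`-rigidity of (i) Shioda's type-II threefold for `(1,1,4,4,4,4)` on `X⁴₆`, (ii) Aoki's
`Y` for `σ_{5,1}` on `X⁴₁₅` — both HC-known, both non-paired; two negatives retire the "printed cycles
are rigid seeds" heuristic and leave only genuinely new objects for `gap₃₅`; a classification "L-rigid
objects of `HMF^{gr,L}(Σxᵢᵐ)` have standard charge" (card F3) kills the stub. Sources: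
Ideas/witt-lift-rigid-mf.md; BFK arXiv:1105.3177 §3 (Künneth), §10; Aoki 1987 Thm 1-1/2-1; Shioda–Katsura
1979; crux 1334 census (Cruxes/HodgeFermatVarieties). -/
theorem stub_rigidSeeds :
    ∀ (m : ℕ) [NeZero m] (s : Multiset (ZMod m)), s ≠ 0 → IsHodgeMultiset s → ¬ StableReach[m, s] →
    ∃ (k : ℕ) (A : Multiset (ZMod ((k + 1) * m))) (r : ℕ) (γ : Fin (2 * r + 2) → ZMod ((k + 1) * m)),
      (∀ a ∈ A, a ≠ 0) ∧ (∀ i, γ i ≠ 0) ∧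
      univ.val.map γ = LevelRaise[k + 1, m, s] + A.bind (fun a ↦ ({a, -a} : Multiset _)) ∧
      Nonempty (RigidSeed ((k + 1) * m) γ) := by
  sorry

/-! **L5 `stub_latticeReduction` — CRUX 1334's LATTICE LAYER (its line `cancel-by-any-claim-lattice`
MINUS the engine stub S4; size XL in total but research risk nil and SHARED: it closes the day 1334's
stubs S0, S1, S2, S3a, S3b, S5 close, by that line's sorry-free `lineImplication` pattern).** For a
level `m ≥ 1`: IF every non-empty Hodge multiset `s` of `ℤ/m` that is not stably reachable from the
printed supply becomes claimed after some level raising `(k+1)•s` and some pair inflation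
`+ Σ_{a∈A} {a, −a}` (`aᵢ ≠ 0`), THEN the Hodge conjecture holds for every smooth projective Fermat
variety of degree `m`. PROOF IN PRINT (all vendored or being proved in the tree): Hodge models exist
(`nonempty_hodgeModel`); the cycle part is `hodgeClasses_algebraic_fermat_of_claims_at'` (tree, PROVED:
Lefschetz off the middle degree discharged, transport to the standard model proved) fed Ran 1980
Prop 1.7 (1334's S5) and claim for every Hodge character `α` of every `X²ᵖₘ`; for the value multiset
`s` of `α`: if `StableReach[m, s]`, 1334's S2 (level change `claim_m(s) ⟺ claim_{km}(k•s)`,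
Shioda–Katsura `[xᵢ] ↦ [xᵢᵏ]`), S3a/S3b (the printed supply is claimed and negation-closed: Aoki 1987
Thm 1-1, 2-1, Aoki–Shioda 1983 (2.1), Shioda's type II) and S1 (the lattice criterion from Aoki Thm
1-4 (i),(ii)) give `claim_m(s)` (1334's `claimMultiset_of_stableReach`, sorry-free there); otherwise the
hypothesis gives `ClaimMultiset ((k+1)m) ((k+1)•s + δ)` with `δ = Σ{a,−a}` paired and zero-free, Aoki
Thm 1-4 (ii) (`Aoki1987_claim_of_claim_juxtaposition_paired`, realising `(k+1)•s` by a Hodge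
character — `IsHodgeMultiset.exists_isHodge_even` + 1334's S2(a) — and `δ` by `FermatCharacter.pairs`)
cancels `δ`, and S2 (`←`, finite push-forward `π_*π^* = deg π`) descends to level `m`. WHY IT MIGHT
FAIL: it cannot short of an error in print; it is deliberately NOT to be worked inside this line (work
it in Cruxes/HodgeFermatVarieties, whose stubs it restates).

GEN 9: no longer a `sorry` of its own — DERIVED below (`latticeReduction_of_stubs`) from the five fact-shaped
stubs through the landed `latticeReduction_of_cancelLatticeStubs` (p141595). -/

/-- **L5a `stub_juxtapositionSpans` — the span / Gysin layer of Shioda's inductive structure** (gen 10: the three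
remaining leaves of Aoki 1987 Thm 1-4 (i), named facts of `Literature/AlgebraicGeometry/HodgeTheory/FermatJuxtapositionSpans`,
verbatim): (II) `Shioda1979_typeIISpan_represents` (the ℙ¹-bundle of lines joining the complementary sub-Fermat varieties,
`π` flat, `π_{α∗β}(φ_*π^*(v ⊠ w)) ≠ 0` — "f(Z₁⊗Z₂) = m·Z₁∧Z₂", Shioda Thm I), (III-l)/(III-r) `Shioda1979_coneSpan_represents_left/right`
(completed cones `ℙ(𝒪 ⊕ 𝒪(−1))`). Leaf (IV) (lines) is a theorem (p170621) and enters `claim_juxtaposition_of_stubs` by name. Size XL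
(needs the incidence varieties as smooth projective schemes with flat projection, their Gysin images, and `V(β) ≠ 0`).
[cite: Aoki1987, Thm. 1-4 (i)] [cite: Shioda1979HodgeFermat, Thm. I] [cite: daSilva2021HodgeFermat, Thm. 2.2] -/
theorem stub_juxtapositionSpans :
    Shioda1979_typeIISpan_represents ∧ Shioda1979_coneSpan_represents_left := by
  sorry

/-! GEN 10: `stub_inductiveSpans` (gen 9: `Aoki1987_claim_juxtaposition ∧ Aoki1987_claim_of_claim_juxtaposition_paired ∧
Shioda1979_claim_semiDecomposable`) is SPLIT. Leaf (IV) `Shioda1979_lines_represent` is a THEOREM (`…_holds`, p170621: lines on the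
Fermat surface represent the paired characters — `g_a^* cl L₀ = cl a⁻¹L₀`, hyperplane class by `G`-averaging, character sums), so
Aoki Thm 1-4 (i) now hinges on the three span leaves (II), (III-l), (III-r) = `stub_juxtapositionSpans` above (ℙ¹-bundle / completed
cones as smooth projective schemes with flat `π`, and the non-vanishing `π_{α∗β}(Φ(v,w)) ≠ 0`; the cone leaves also need `V(β) ≠ 0`,
i.e. `stub_eigenclassExists` below); Thm 1-4 (ii) and the semi-decomposable sextuples form `stub_pairedAndSemiDecomposable`. -/

/-- **L5a′ `stub_pairedAndSemiDecomposable` — Aoki 1987 Thm 1-4 (ii) (paired cancellation: the inductive structure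
read backwards) and Shioda 1979 PJA §4 (semi-decomposable Hodge sextuples of `X⁴ₘ`; leaf = one representing ruled join
of curves, `Shioda1979_claim_semiDecomposable_holds_of_join`, p163837).** Both need the span layer of
`stub_juxtapositionSpans` (Künneth + slicing against `V(−δ)` for (ii)). Size XL. [cite: Aoki1987, Thm. 1-4 (ii)]
[cite: Shioda1979PJA, §4] [cite: Ran1980, §4 Cor. 4.7] -/
theorem stub_pairedAndSemiDecomposable :
    Aoki1987_claim_of_claim_juxtaposition_paired ∧ Shioda1979_claim_semiDecomposable := by
  sorry

/-- Aoki 1987 Thm 1-4 (i) from the two remaining span leaves (II), (III-l), the landed mirror (III-l) ⟹ (III-r) (p171599) and the landed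
leaf (IV) (`Shioda1979_lines_represent_holds`, p170621) through `Aoki1987_claim_juxtaposition_holds_of_spans` (p163837). [cite: Aoki1987, Thm. 1-4 (i)] -/
theorem claim_juxtaposition_of_stubs : Aoki1987_claim_juxtaposition :=
  Aoki1987_claim_juxtaposition_holds_of_spans stub_juxtapositionSpans.1 stub_juxtapositionSpans.2
    (Shioda1979_coneSpan_represents_right_of_left stub_juxtapositionSpans.2) Shioda1979_lines_represent_holds

/-- **L5b `stub_pStandard` — Aoki 1987 Thm 2-1: the standard elements `σ_{p,a}` are claimed** (named fact,
verbatim; ONE open leaf `Aoki1987_thm_2_1_supportedClass` — a class supported on Aoki's complete intersection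
`Y` with `π_σ(c) ≠ 0` — via `Aoki1987_claim_pStandard_holds_of_supportedClass`, p163837). Size L–XL.
[cite: Aoki1987, Thm. 2-1 and §3–§4] -/
theorem stub_pStandard : Aoki1987_claim_pStandard := by
  sorry

/-! GEN 10: L5c `stub_surfaceEigenlines` is DISCHARGED — `AokiShioda1983_eigenline_le_neronSeveri` is a THEOREM of the tree
(`AokiShioda1983_eigenline_le_neronSeveri_holds`, p170565, Literature/AlgebraicGeometry/HodgeTheory/AokiShiodaSurfaceEigenlinesHolds.lean:
HodgeModel → concrete model, the ratio of a closed `χ_β`-eigen (2,0)-form by a residue form is holomorphic on a generic line of the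
`μₘ³`-quotient plane and decays at the fibre at infinity because `|β| = 2` forces `⟨β₁⟩+⟨β₂⟩+⟨β₃⟩ ≥ m+1`; Liouville; density). It is used
BY NAME in `latticeReduction_of_stubs`. -/

/-! GEN 11: L5d′ `stub_eigenclassExists` (Ran 1980 Prop. 1.7 (i), existence half) is DISCHARGED — `Ran1980_fermatEigenspace_ne_bot`
(Literature/AlgebraicGeometry/HodgeTheory/FermatEigenspaceNonvanishing.lean, p171879), and S2↑ (`stub_claimLevelPull` of gen 9, crux 1334's registered
statement verbatim) is the UNCONDITIONAL theorem `claimLevelPull` (Theorems/PadicSemiregularLiftFermatAnchorAssemblyStubEigenclassExists.lean, p172068: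
`claimLevelPull_of_exists_eigenclass Ran1980_fermatEigenspace_ne_bot`, Fulton eliminated by p168368, Bredon by the eigenspace count p168540). Used BY NAME below. -/


/-- **L5e `stub_hodgeTypePP` — Ran 1980 Prop. 1.7 (ii), `(p,p)` case: the Hodge type of a zero-free Fermat
eigenline** (named fact, verbatim; the conclusion is automatic on `𝔅`, `Ran1980_fermatEigenspace_hodgeType_pp_of_isHodge`).
GEN 10 state: wave 2 reduced it to ONE general published theorem — Griffiths 1969 Thm. 8.3 / Voisin II Thm. 6.5, the residues
`Res(PΩ/Fˡ)` span `F^{n+1−l}Hⁿ` naturally under the diagonal symmetries (named fact `Griffiths1969_residues_span_hodgeFiltration`,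
Literature/AlgebraicGeometry/HodgeTheory/GriffithsResidueComparison.lean, p167563) — by the character count of the Jacobian ring:
`Ran1980_fermatEigenspace_hodgeType_pp_holds_of_griffithsResidues` (Literature/…/FermatEigenlineHodgeTypesOfGriffithsResidues.lean,
p170905; the same fact re-proves Aoki–Shioda (2.1)). The tree's residue theory is pole order 1 only (`residueForm`); pole order ≥ 2
needs `Hⁿ⁺¹(ℙ ∖ X)`, the Leray residue and the pole-order/Hodge comparison. Size XL.
[cite: Ran1980, §1 Prop. 1.7 (ii)] [cite: Shioda1979HodgeFermat, §1 (1.7)] [cite: Griffiths1969, Thm. 8.3] [cite: VoisinHodgeII2003, Thm. 6.5] -/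
theorem stub_hodgeTypePP : Ran1980_fermatEigenspace_hodgeType_pp := by
  sorry

/-- **The registered `stub_latticeReduction` statement, DERIVED** (sorry-free) from the fact-shaped stubs and the
landed facts through `latticeReduction_of_cancelLatticeStubs` (p141595: Hodge models, the per-degree assembly, the
lattice criterion S1, level change S2, printed supply S3, Pham S5a). [folklore assembly] -/
theorem latticeReduction_of_stubs : ReductionStatement := fun m _ ↦
  latticeReduction_of_cancelLatticeStubs
    ⟨claim_juxtaposition_of_stubs, stub_pairedAndSemiDecomposable.1, stub_pStandard,
      AokiShioda1983_eigenline_le_neronSeveri_holds, stub_pairedAndSemiDecomposable.2⟩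
    claimLevelPull stub_hodgeTypePP m

/-! ### The composition: the five stub statements imply the crux, by name -/

/-- **The ENGINE of the line for one residual class** (sorry-free logic over the stub statements):
seed ↦ Witt lift ↦ characteristic-zero model with the same charge polynomial ↦ readout. [folklore assembly] -/
theorem claim_of_rigidSeed (hR : ReadoutStatement) (hL : LiftStatement) (hB : BaseChangeStatement)
    {M' r : ℕ} [NeZero M'] {γ : Fin (2 * r + 2) → ZMod M'} (hγ : ∀ i, γ i ≠ 0) (W : RigidSeed M' γ) :
    Claim M' r γ := by
  haveI := W.prime; letI := W.field; haveI := W.charP; haveI := W.perfect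
  letI := W.fin₀; letI := W.fin₁; letI := W.dec₀; letI := W.dec₁
  -- lift the rigid seed to the Witt vectors
  obtain ⟨MW, hMW⟩ := hL W.p W.𝕜 (2 * r + 2) M' W.ι₀ W.ι₁ W.L W.M W.rigid
  -- pass to a field of characteristic zero without changing the charge polynomial
  obtain ⟨C⟩ := hB W.p W.𝕜 (2 * r + 2) M' W.not_dvd W.ζ W.prim γ W.ι₀ W.ι₁ W.L MW
  letI := C.field; haveI := C.charZero
  refine hR M' r C.K C.ζ C.prim γ hγ W.ι₀ W.ι₁ W.L C.N ?_
  rw [C.theta_eq, hMW]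
  exact W.charged

/-- `LineImplication` — the shape of the line as one proposition. -/
abbrev LineImplication : Prop :=
  ReadoutStatement → LiftStatement → BaseChangeStatement → SeedStatement → ReductionStatement →
    FermatAnchorAssembly

/-- **The five stub statements imply the crux** (sorry-free): per degree `m ≥ 1` the reduction stub is
fed, for each residual class, the claim produced by the engine `claim_of_rigidSeed` from the seed stub
(`claimMultiset_univ_val_map_iff` turns the one arrangement `γ` into `ClaimMultiset`); `m = 0` is vacuous
(landed `HodgeFermatVarietiesNegative.degree_zero_vacuous`); the crux follows from its consequent by the
landed `FermatAnchorAssemblyAfterPridham.fermatAnchorAssembly_of_hodgeFermatVarieties`. [folklore assembly] -/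
theorem lineImplication : LineImplication := by
  intro hR hL hB hS hRed
  refine Summit.HodgeConjecture.HodgeConjecture.Theorems.FermatAnchorAssemblyAfterPridham.fermatAnchorAssembly_of_hodgeFermatVarieties ?_
  intro n m X hF hX
  rcases Nat.eq_zero_or_pos m with rfl | hm
  · exact (Summit.HodgeConjecture.HodgeConjecture.Theorems.HodgeFermatVarietiesNegative.degree_zero_vacuous hF hX).elim
  haveI : NeZero m := ⟨by omega⟩
  refine hRed m (fun s hs0 hs hns ↦ ?_) hF hX
  obtain ⟨k, A, r, γ, hA, hγ0, hγ, ⟨W⟩⟩ := hS m s hs0 hs hns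
  refine ⟨k, A, hA, ?_⟩
  rw [← hγ, claimMultiset_univ_val_map_iff]
  exact claim_of_rigidSeed hR hL hB hγ0 W

/-- **`FermatAnchorAssembly_of` — the crux BY NAME from the five registered stubs** (kernel-checked;
the only `sorry`s of the file live inside `stub_*`). -/
theorem FermatAnchorAssembly_of : FermatAnchorAssembly :=
  lineImplication (readout_of_core Ran1980_fermatEigenspace_le_span_holds (readoutCore_of_complexStub stub_readoutCoreComplex))
    stub_rigidLift stub_eulerBaseChange stub_rigidSeeds latticeReduction_of_stubs

end Summit.HodgeConjecture.HodgeConjecture.Cruxes.FermatAnchorAssembly.WittLiftRigidMf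

end
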